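/-
Copyright (c) 2026 the pub-hodgecm-mathlib formalisation cell (harness21).  Prover seat hodgecm-mathlib-LH4-p19 (g2), req620 Track A «(D-RAM) FOUR-FRAME» squad
(STAGE-1b, row (2) of the piece `f_{T₊}`, the (β₂) road (R-36) «PURE-CELL LEDGER»; β₂ sub-dealer LH4-p04 (g9) rows (ROW-D♭) ∕ (ROW-SMALL-2); the per-vertex label read of the
diagonal cell in the small regime), 2026-09-05.
-/
import Summits.HodgeConjecture.HodgeConjecture.Theorems.F0P3cDyRamRayScalarNearlyFixed             -- ★ p863048 (LH4-p16 (g2)): `exists_fixed_unit_valueSet_endoGL_sub_one_glued_eq_smul_xPlus`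
import Summits.HodgeConjecture.HodgeConjecture.Theorems.F0P3cDyRamDiagonalCellGeneratorIndependence  -- ★ p863081 (this seat, K5c): `coords_letters_of_gen`; brings ★ K3 `trace_scalar_eq_coords`, `v_coords_scalar`
import Summits.HodgeConjecture.HodgeConjecture.Theorems.F0P3cDyRamSmulXPlusLabel                    -- ★ (LH4-p13 (g7)): `labelPlus_smul_xPlus_iff_exists_norm`
import Literature.NumberTheory.LocalFields.ValuedCompleteIsAdicComplete                            -- ★ BRIDGE-AC: `isAdicComplete_valuedInteger_of_completeSpace`
import HarnessLib

/-!
# Crux `H413`, line LH4 «(D-RAM) FOUR-FRAME» — STAGE-1b, row (2), the (β₂) road (R-36), lane B, rows (ROW-D♭) ∕ (ROW-SMALL-2) — THE PER-VERTEX LABEL READ OF THE DIAGONAL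
# CELL IN THE SMALL REGIME: «a glued vertex over `Λ = x₀·𝒪_b` is labelled `+` iff `ω_σ(T̂)·ω_σ(α₁ + γ₁V̂) = 1`»

Cell `hodgecm-mathlib` (D-0151), FLOOR 0, crux item H413 = `stmt-HodgeConjecture-24833`, route of record `HCCMUnconditional`; squad F0∕P3c∕LH4; lane
`--supports stmt-HodgeConjecture-24833 --as helper` (count-neutral; pays NO tier-0 row).  THEOREMS ONLY (no `def`, no instance, no notation, no `sorry`, default heartbeats);
★-only imports; states NO law; (β₂) stays a HYPOTHESIS.  Letters = ★ p863048's glued-vertex frame (plane `(H₂, h_W)`, `Γ = endoGL (γ₂, u)`, line model `jE ρ Θ α φ lam h`, a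
vertex `L` glued over `(B₂, w₀, g₀)` presenting `Λ = x₀·𝒪_b`) on the DIAGONAL cell of the live row (`cc = jEϖ^b`, `|Y| = |jEϖ|^b`, `|μ| = exp(−2b)`, `|μ − ρμ| = exp(−(2b + 2g))`,
`1 ≤ g`), the sheet datum on `E` (`d` even), a `Θ`-fixed pivot `θ₀`, the `E`-side coordinates `â, b̂` of `μ̂ = μ∕(ϖEΘϖE)^b` (`jE â = Â`, `jE b̂ = B̂`, ★ K3), affine letters
`α₁, γ₁` with ★ K4's sign property as a HYPOTHESIS (`haff`), preimages `T̂, V̂` of the coordinates `T(x₀), V(x₀)`, the depth clause of `Λ`, and deep tokens at a level `n` with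
`3d − 2 + d%2 ≤ n ≤ 2b + 2g`, `m* ≤ 2b`, `m* ≤ b + 2g`.

WHY (read (hL₁)(hL₂) of ★ K7 `cellDiff_diag_eq_zero_of_reads`; memo MECH-LDflat §3).  ★ p863048 gives a `σ`-fixed unit `e′` with `VS_{m*}(Γ − 1 ∣ L) = valueSetMod σ ϖ m* (e′ • X₊)`
and `|e₀ − e′·t₊| ≤ |ϖ|^{m*}` for the ray scalar `jE e₀ = Tr_ρ(μ∕D₀)`; ★ K3 `trace_scalar_eq_coords` says `Tr_ρ(μ∕D₀) = Â·T + B̂·W = T·(Â + B̂V)`, so `e₀ = T̂·(â + b̂V̂)`;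
★ K4's property turns `|T̂(â + b̂V̂) − e′t₊| ≤ |ϖ|^{m*}` into `ω(e′) = ω(T̂)·ω(α₁ + γ₁V̂)`; and ★ `labelPlus_smul_xPlus_iff_exists_norm` says `valueSetMod (e′ • X₊) = valueSetMod X₊ ⟺ e′ ∈ N`.
* §1 `v_hatmu_letters_of_row` — the ray-domination element `μt = μ∕jE(ϖ^{m*})` lies in `𝒪_cc`; the skew token `|μ∕Y|·|lam − ρlam| ≤ |jEϖ|^n·|cc(α − ρα)|`.
* §2 HEAD `valueSet_eq_xPlus_iff_affineSign` — `VS_{m*}(Γ − 1 ∣ L) = valueSetMod σ ϖ m* X₊ ↔ normSign σ T̂ * normSign σ (α₁ + γ₁ * V̂) = 1`.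
WHAT IS NOT CLAIMED: the existence of the glued vertex, the shells, the transfer between generators, the cell count — ★ elsewhere (this seat's K5c∕K7∕K7b, LH4-p06's ★ p863084).
HONEST LABEL.  Count-neutral per-vertex bookkeeping; nothing printed is asserted; no census law is stated; `HC_CM` is proved only modulo the 7 printed citations (2 remaining named
inputs: hLiu418 = `stmt-HodgeConjecture-24832`, h413 = `stmt-HodgeConjecture-24833`) until rung 0 closes.
## References
* [Jacobowitz1962] R. Jacobowitz, *Hermitian forms over local fields*, Amer. J. Math. 84 (1962): §4 (dual lattices, norm-residue gluing).
* [Rogawski1990] J. D. Rogawski, *Automorphic Representations of Unitary Groups in Three Variables*, Ann. of Math. Stud. 123 (1990): §4.9 Prop. 4.9.1 (b) p. 55.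
* [Kottwitz1986BaseChangeUnits] R. E. Kottwitz, *Base change for unit elements of Hecke algebras*, Compositio Math. 60 (1986): §1 pp. 240–241.
* [Serre1979] J.-P. Serre, *Local Fields*, GTM 67 (1979): Ch. I §6 Prop. 18; Ch. V §2 Prop. 3, §3 Cor. 3 pp. 85–87.
* [LanglandsShelstad1987] R. P. Langlands, D. Shelstad, *On the definition of transfer factors*, Math. Ann. 278 (1987): §1–§3.
-/

set_option autoImplicit false

noncomputable section

namespace Summit.HodgeConjecture.HodgeConjecture.Cruxes.H413.F0P3cDyRamDiagonalCellVertexRead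

open scoped Valued WithZero Matrix MatrixGroups
open WithZero
open Literature.NumberTheory.Automorphic Literature.NumberTheory.Automorphic.HermitianLattice Literature.NumberTheory.Automorphic.UnitaryLatticeTree
open Literature.NumberTheory.Automorphic.UnitaryThreeFourFrame (IsRamifiedQuadraticDatum normSign normSign_of_isNorm normSign_of_not_isNorm)
open Literature.NumberTheory.Rogawski1990
open Literature.NumberTheory.LocalFields (isAdicComplete_valuedInteger_of_completeSpace)
open Summit.HodgeConjecture.HodgeConjecture.Cruxes.H413.F0P3cDyRamFourFramePieces
open Summit.HodgeConjecture.HodgeConjecture.Cruxes.H413.F0P3cDyRamToricCensusDefs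
open Summit.HodgeConjecture.HodgeConjecture.Cruxes.H413.F0P3cDyRamRayScalarNearlyFixed (exists_fixed_unit_valueSet_endoGL_sub_one_glued_eq_smul_xPlus)
open Summit.HodgeConjecture.HodgeConjecture.Cruxes.H413.F0P3cDyRamSmulXPlusLabel (labelPlus_smul_xPlus_iff_exists_norm)
open Summit.HodgeConjecture.HodgeConjecture.Cruxes.H413.F0P3cDyRamDiagonalCellCoordinates (trace_scalar_eq_coords v_coords_scalar)
open Summit.HodgeConjecture.HodgeConjecture.Cruxes.H413.F0P3cDyRamDiagonalCellGeneratorIndependence (coords_letters_of_gen)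

variable {E M : Type} [Field E] [Valued E ℤᵐ⁰] [Field M] [Valued M ℤᵐ⁰] {ρ Θ : M →+* M} {α : M}

/-! ## §1 The ray-domination element and the skew token on the diagonal cell -/

omit [Valued E ℤᵐ⁰] in
/-- **RAY DOMINATION AND SKEW ON THE DIAGONAL CELL.**  `ρ` isometric, `|α| ≤ 1`, `|α − ρα| = 1`, `jE` isometric onto `Fix ρ`, `|jEϖ| = exp(−1)`; `μ` with `|μ| = |jEϖ|^{2b}`,
`|μ − ρμ| = |jEϖ|^{2b+2g}` (the diagonal cell of the live row at `δ = 2g`), `Y` with `|Y| = |jEϖ|^b`, and levels `k ≤ 2b`, `k ≤ b + 2g`, `n ≤ 2b + 2g`.  THEN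
`μ = jE(ϖ^k)·μt` with `IsOrd ρ α (jEϖ^b) μt`, and `|μ∕Y|·|lam − ρlam| ≤ |jEϖ|^n·|jEϖ^b·(α − ρα)|` whenever `lam − ρlam = μ − ρμ`.
[cite: Serre1979, Ch. III §6 Prop. 12] [cite: Jacobowitz1962, §4] -/
theorem v_hatmu_letters_of_row (hU : Valued.v (α - ρ α) = 1)
    (jE : E →+* M) (hjfix : ∀ z, ρ z = z ↔ ∃ c, jE c = z)
    {ϖ : E} (hϖM : Valued.v (jE ϖ) = exp (-1 : ℤ)) {μ Y lam : M} {b g k n : ℕ}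
    (hμv : Valued.v μ = Valued.v (jE ϖ) ^ (2 * b)) (hμρ : Valued.v (μ - ρ μ) = Valued.v (jE ϖ) ^ (2 * b + 2 * g))
    (hlamμ : lam - ρ lam = μ - ρ μ) (hYv : Valued.v Y = Valued.v (jE ϖ) ^ b)
    (hk2b : k ≤ 2 * b) (hkg : k ≤ b + 2 * g) (hn : n ≤ 2 * b + 2 * g) :
    (μ = jE (ϖ ^ k) * (μ / jE (ϖ ^ k)) ∧ IsOrd ρ α (jE ϖ ^ b) (μ / jE (ϖ ^ k))) ∧
      Valued.v (μ / Y) * Valued.v (lam - ρ lam) ≤ Valued.v (jE ϖ) ^ n * Valued.v (jE ϖ ^ b * (α - ρ α)) := by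
  have hvϖ0 : Valued.v (jE ϖ) ≠ 0 := by rw [hϖM]; exact exp_ne_zero
  have hjϖ0 : jE ϖ ≠ 0 := fun h0 => by rw [h0, map_zero] at hvϖ0; exact hvϖ0 rfl
  have hϖ1 : Valued.v (jE ϖ) ≤ 1 := by rw [hϖM, ← exp_zero, exp_le_exp]; norm_num
  have hpk0 : jE (ϖ ^ k) ≠ 0 := by rw [map_pow]; exact pow_ne_zero _ hjϖ0
  have hρpk : ρ (jE (ϖ ^ k)) = jE (ϖ ^ k) := (hjfix _).2 ⟨_, rfl⟩
  refine ⟨⟨by rw [mul_div_cancel₀ _ hpk0], ?_, ?_⟩, ?_⟩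
  · -- `|μt| ≤ 1`
    rw [map_div₀, map_pow, Valuation.map_pow, hμv, div_le_one₀ (pow_pos (zero_lt_iff.2 hvϖ0) _)]
    exact pow_le_pow_right_of_le_one' hϖ1 hk2b
  · -- `|μt − ρμt| ≤ |cc(α − ρα)|`
    have e : μ / jE (ϖ ^ k) - ρ (μ / jE (ϖ ^ k)) = (μ - ρ μ) / jE (ϖ ^ k) := by rw [map_div₀, hρpk, sub_div]
    rw [e, map_div₀, hμρ, map_pow, Valuation.map_pow, Valuation.map_mul, Valuation.map_pow, hU, mul_one,
      div_le_iff₀ (pow_pos (zero_lt_iff.2 hvϖ0) _), ← pow_add]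
    exact pow_le_pow_right_of_le_one' hϖ1 (by omega)
  · rw [hlamμ, map_div₀, hμv, hYv, hμρ, Valuation.map_mul, Valuation.map_pow, hU, mul_one]
    have e1 : Valued.v (jE ϖ) ^ (2 * b) / Valued.v (jE ϖ) ^ b = Valued.v (jE ϖ) ^ b := by
      rw [div_eq_iff (pow_ne_zero _ hvϖ0), ← pow_add]; congr 1; omega
    rw [e1, ← pow_add, ← pow_add]
    exact pow_le_pow_right_of_le_one' hϖ1 (by omega)

/-! ## §2 HEAD — the per-vertex label read -/

/-- **HEAD — «A GLUED VERTEX OVER `Λ = x₀·𝒪_b` IS LABELLED `+` IFF `ω_σ(T̂)·ω_σ(α₁ + γ₁V̂) = 1`».**  ★ p863048's glued-vertex frame on the DIAGONAL cell of the live row `2b = m`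
at `δ = 2g` (`1 ≤ g`, `d` even, `m* ≤ 2b`, `m* ≤ b + 2g`), deep tokens at `n` (`3d − 2 ≤ n ≤ 2b + 2g`): `|lam − 1| ≤ |jEϖ|^n`, `|u₀₀ − 1| ≤ |ϖ|^n`; a `Θ`-fixed pivot
`θ₀` (`|θ₀| ≤ 1`, `|θ₀ − ρθ₀| = 1`), the `E`-coordinates `â b̂` of `μ̂ = μ∕(ϖEΘϖE)^b` (★ K3), affine letters `α₁ γ₁` carrying ★ K4's sign property (`haff`), preimages `T̂ V̂` of
`T(x₀) = Tr_ρ ŵ`, `V(x₀) = Tr_ρ(θ₀ŵ)∕Tr_ρ ŵ`.  THEN `VS_{m*}(Γ − 1 ∣ L) = valueSetMod σ ϖ m* X₊ ↔ normSign σ T̂ * normSign σ (α₁ + γ₁ * V̂) = 1`.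
[cite: Jacobowitz1962, §4] [cite: Rogawski1990, §4.9 Prop. 4.9.1 (b) p. 55] [cite: Serre1979, Ch. I §6 Prop. 18; Ch. V §3 Cor. 3] [cite: LanglandsShelstad1987, §1–§3] -/
theorem valueSet_eq_xPlus_iff_affineSign [CompleteSpace E] {σ : E →+* E} {ϖ : E} {d t : ℕ} (hD : IsRamifiedQuadraticDatum σ ϖ d t) (hd0 : d % 2 = 0)
    (H₂ : Matrix (Fin 2) (Fin 2) E) (hW : E)
    (jE : E →+* M) (hjv : ∀ c, Valued.v (jE c) ≤ 1 ↔ Valued.v c ≤ 1) (hjfix : ∀ z, ρ z = z ↔ ∃ c, jE c = z) (hjiso : ∀ a, Valued.v (jE a) = Valued.v a)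
    (hρρ : ∀ x, ρ (ρ x) = x) (hvρ : ∀ x, Valued.v (ρ x) = Valued.v x) (hα : ρ α ≠ α) (hα1 : Valued.v α ≤ 1)
    (hintρ : ∀ z : M, Valued.v z ≤ 1 → Valued.v ((z - ρ z) / (α - ρ α)) ≤ 1)
    (hΘΘ : ∀ x, Θ (Θ x) = x) (hΘρ : ∀ x, Θ (ρ x) = ρ (Θ x)) (hvΘ : ∀ x, Valued.v (Θ x) = Valued.v x) (hΘj : ∀ c, Θ (jE c) = jE (σ c))
    (hU : Valued.v (α - ρ α) = 1) (hram : Valued.v (α - Θ α) < 1)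
    (φ : (Fin 2 → E) →+ M) (hφs : ∀ (c : E) (x : Fin 2 → E), φ (c • x) = jE c * φ x)
    {γ₂ : GL (Fin 2) E} {lam h : M} (hφγ : ∀ x, φ ((γ₂ : Matrix (Fin 2) (Fin 2) E) *ᵥ x) = lam * φ x) (hh : h ≠ 0) (hΘh : Θ h = h)
    (hform : ∀ x y, jE (pairing σ H₂ x y) = h * Θ (φ x) * φ y + ρ (h * Θ (φ x) * φ y))
    {L : Submodule 𝒪[E] (Fin 3 → E)} {b : ℕ} (hpr : ∀ x ∈ L, Valued.v (x 1) * Valued.v ϖ ^ b ≤ 1)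
    (hintL : ∀ y ∈ L, Valued.v (pairing σ (!![H₂ 0 0, 0, H₂ 0 1; 0, hW, 0; H₂ 1 0, 0, H₂ 1 1] : Matrix (Fin 3) (Fin 3) E) y y) ≤ 1)
    {B₂ : Submodule 𝒪[E] (Fin 2 → E)} {w₀ : Fin 2 → E} {g₀ : Fin 3 → E}
    (hB : B₂.map ((Matrix.toLin' (!![1, 0; 0, 0; 0, 1] : Matrix (Fin 3) (Fin 2) E)).restrictScalars 𝒪[E]) =
      L ⊓ LinearMap.ker ((LinearMap.proj (1 : Fin 3) : (Fin 3 → E) →ₗ[E] E).restrictScalars 𝒪[E]))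
    (hg₀ : g₀ ∈ L) (hg₀1 : Valued.v (g₀ 1) * Valued.v ϖ ^ b = 1) (hprg : g₀ - Pi.single 1 (g₀ 1) = ![w₀ 0, 0, w₀ 1])
    (u : GL (Fin 1) E) {x₀ : M} (hx₀ : x₀ ≠ 0) {Λ : AddSubgroup M} (hBΛ : B₂.toAddSubgroup.map φ = Λ)
    (hΛx : ∀ x, x ∈ Λ ↔ ∃ ζ, IsOrd ρ α (jE ϖ ^ b) ζ ∧ x = x₀ * ζ) (hw₀Y : φ w₀ = (dualGen ρ Θ α (jE ϖ ^ b) h x₀)⁻¹ * x₀)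
    (hYO : IsOrd ρ α (jE ϖ ^ b) (dualGen ρ Θ α (jE ϖ ^ b) h x₀)) (hYprim : ¬ IsOrd ρ α (jE ϖ ^ b) (dualGen ρ Θ α (jE ϖ ^ b) h x₀ / jE ϖ))
    (hYv : Valued.v (dualGen ρ Θ α (jE ϖ ^ b) h x₀) = Valued.v (jE ϖ) ^ b)
    (hdep : ∀ b', (∀ x ∈ Λ, Valued.v (h * Θ x * b' + ρ (h * Θ x * b')) ≤ 1) → (lam - jE ((u : Matrix (Fin 1) (Fin 1) E) 0 0)) * b' ∈ Λ)
    -- the line structure and the row letters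
    (hΘlam : Θ lam * lam = 1) (hvlam : Valued.v lam = 1) (huu : ((u : Matrix (Fin 1) (Fin 1) E) 0 0) * σ ((u : Matrix (Fin 1) (Fin 1) E) 0 0) = 1)
    {g : ℕ} (hg1 : 1 ≤ g) (hb1 : 1 ≤ b) (hmb : mstarOfRecord d ≤ 2 * b) (hmg : mstarOfRecord d ≤ b + 2 * g)
    (hm : Valued.v (lam - jE ((u : Matrix (Fin 1) (Fin 1) E) 0 0)) = Valued.v (jE ϖ) ^ (2 * b))
    (hjl : Valued.v ((lam - jE ((u : Matrix (Fin 1) (Fin 1) E) 0 0)) - ρ (lam - jE ((u : Matrix (Fin 1) (Fin 1) E) 0 0))) = Valued.v (jE ϖ) ^ (2 * b + 2 * g))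
    {n : ℕ} (hn : 3 * d - 2 + d % 2 ≤ n) (hn' : n ≤ 2 * b + 2 * g)
    (hlamn : Valued.v (lam - 1) ≤ Valued.v (jE ϖ) ^ n) (hun : Valued.v ((u : Matrix (Fin 1) (Fin 1) E) 0 0 - 1) ≤ Valued.v ϖ ^ n)
    -- the pivot, the coordinates of `μ̂`, the affine letters, the preimages of `T(x₀)`, `V(x₀)`
    {θ₀ : M} (hΘθ₀ : Θ θ₀ = θ₀) (hθ1 : Valued.v θ₀ ≤ 1) (hθρ : Valued.v (θ₀ - ρ θ₀) = 1)
    {â bh : E}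
    (hâ : jE â = (lam - jE ((u : Matrix (Fin 1) (Fin 1) E) 0 0)) / (jE ϖ * Θ (jE ϖ)) ^ b -
      ((lam - jE ((u : Matrix (Fin 1) (Fin 1) E) 0 0)) / (jE ϖ * Θ (jE ϖ)) ^ b - ρ ((lam - jE ((u : Matrix (Fin 1) (Fin 1) E) 0 0)) / (jE ϖ * Θ (jE ϖ)) ^ b)) /
        (θ₀ - ρ θ₀) * θ₀)
    (hbh : jE bh = ((lam - jE ((u : Matrix (Fin 1) (Fin 1) E) 0 0)) / (jE ϖ * Θ (jE ϖ)) ^ b -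
      ρ ((lam - jE ((u : Matrix (Fin 1) (Fin 1) E) 0 0)) / (jE ϖ * Θ (jE ϖ)) ^ b)) / (θ₀ - ρ θ₀))
    {α₁ γ₁ : E}
    (haff : ∀ (T V f : E), σ T = T → Valued.v T = 1 → σ V = V → Valued.v V ≤ 1 → σ f = f →
      Valued.v (T * (â + bh * V) - f * ((ϖ - σ ϖ) * ((ϖ * σ ϖ) ^ ((d - d % 2) / 2))⁻¹)) ≤ Valued.v ϖ ^ mstarOfRecord d →
      normSign σ f = normSign σ T * normSign σ (α₁ + γ₁ * V))
    {Th Vh : E}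
    (hTh : jE Th = (((α - ρ α) * Θ (α - ρ α)) * (h * (x₀ * Θ x₀)))⁻¹ + ρ (((α - ρ α) * Θ (α - ρ α)) * (h * (x₀ * Θ x₀)))⁻¹)
    (hVh : jE Vh = (θ₀ * (((α - ρ α) * Θ (α - ρ α)) * (h * (x₀ * Θ x₀)))⁻¹ + ρ (θ₀ * (((α - ρ α) * Θ (α - ρ α)) * (h * (x₀ * Θ x₀)))⁻¹)) /
      ((((α - ρ α) * Θ (α - ρ α)) * (h * (x₀ * Θ x₀)))⁻¹ + ρ (((α - ρ α) * Θ (α - ρ α)) * (h * (x₀ * Θ x₀)))⁻¹)) :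
    ({z : E | ∃ y ∈ L, Valued.v ((ϖ ^ mstarOfRecord d)⁻¹ * (z - pairing σ (!![H₂ 0 0, 0, H₂ 0 1; 0, hW, 0; H₂ 1 0, 0, H₂ 1 1] : Matrix (Fin 3) (Fin 3) E) y
        ((((endoGL (γ₂, u) : GL (Fin 3) E) : Matrix (Fin 3) (Fin 3) E) - 1) *ᵥ y))) ≤ 1} = valueSetMod σ ϖ (mstarOfRecord d) (xPlus σ ϖ d)) ↔
      normSign σ Th * normSign σ (α₁ + γ₁ * Vh) = 1 := by
  obtain ⟨hσσ, hvσ, hϖ, -, -, hd1, -⟩ := id hD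
  haveI := isAdicComplete_valuedInteger_of_completeSpace (K := E) hϖ
  -- letters
  have hϖM : Valued.v (jE ϖ) = exp (-1 : ℤ) := by rw [hjiso, hϖ]
  have hvϖ0 : Valued.v (jE ϖ) ≠ 0 := by rw [hϖM]; exact exp_ne_zero
  have hjϖ0 : jE ϖ ≠ 0 := fun h0 => by rw [h0, map_zero] at hvϖ0; exact hvϖ0 rfl
  have hϖ1 : Valued.v (jE ϖ) ≤ 1 := by rw [hϖM, ← exp_zero, exp_le_exp]; norm_num
  have hϖ1E : Valued.v ϖ ≤ 1 := by rw [← hjiso]; exact hϖ1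
  have hρϖ : ρ (jE ϖ) = jE ϖ := (hjfix _).2 ⟨ϖ, rfl⟩
  have hα0 : α - ρ α ≠ 0 := fun h0 => by rw [h0, map_zero] at hU; exact zero_ne_one hU
  have hc : ρ (jE ϖ ^ b) = jE ϖ ^ b := by rw [map_pow, hρϖ]
  have hc0 : jE ϖ ^ b ≠ 0 := pow_ne_zero _ hjϖ0
  have hc1 : Valued.v (jE ϖ ^ b) ≤ 1 := by rw [Valuation.map_pow]; exact pow_le_one₀ zero_le hϖ1
  have hcc : jE ϖ ^ b * (α - ρ α) ≠ 0 := mul_ne_zero hc0 hα0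
  have hθ₀ : ρ θ₀ ≠ θ₀ := fun h0 => by rw [h0, sub_self, map_zero] at hθρ; exact zero_ne_one hθρ
  set μ : M := lam - jE ((u : Matrix (Fin 1) (Fin 1) E) 0 0) with hμdef
  -- the coordinates of the generator (★ K5c)
  obtain ⟨-, -, -, hTv, hρT, hΘT, hρV, hΘV, hV1, hfact⟩ :=
    coords_letters_of_gen hρρ hvρ hΘΘ hΘρ hvΘ hU hram hΘh hρϖ hϖM hΘθ₀ hθ1 hθρ hb1 hYprim hYv
  set T : M := (((α - ρ α) * Θ (α - ρ α)) * (h * (x₀ * Θ x₀)))⁻¹ + ρ (((α - ρ α) * Θ (α - ρ α)) * (h * (x₀ * Θ x₀)))⁻¹ with hTdef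
  set W : M := θ₀ * (((α - ρ α) * Θ (α - ρ α)) * (h * (x₀ * Θ x₀)))⁻¹ + ρ (θ₀ * (((α - ρ α) * Θ (α - ρ α)) * (h * (x₀ * Θ x₀)))⁻¹) with hWdef
  have hT0 : T ≠ 0 := fun h0 => by rw [h0, map_zero] at hTv; exact zero_ne_one hTv
  have hWTV : W = T * (W / T) := by rw [mul_div_cancel₀ _ hT0]
  -- `E`-side letters of `T̂`, `V̂`
  have hσTh : σ Th = Th := jE.injective (by rw [← hΘj, hTh, hΘT])
  have hTh1 : Valued.v Th = 1 := by rw [← hjiso, hTh, hTv]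
  have hσVh : σ Vh = Vh := jE.injective (by rw [← hΘj, hVh, hΘV])
  have hVh1 : Valued.v Vh ≤ 1 := by rw [← hjiso, hVh]; exact hV1
  -- the sizes of the coordinates of `μ̂` (★ K3)
  have hjl' : Valued.v (μ - ρ μ) = Valued.v (jE ϖ ^ (2 * b + 2 * g) * (α - ρ α)) := by
    rw [Valuation.map_mul, Valuation.map_pow, hU, mul_one]; exact hjl
  obtain ⟨hmuh1, hBhv, hAh1⟩ := v_coords_scalar (ρ := ρ) (Θ := Θ) (α := α) (b := b) (μ := μ) hΘρ hvΘ hρϖ hϖM hθ1 hθρ hU hm hjl' hg1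
  have hâ1 : Valued.v â = 1 := by rw [← hjiso, hâ]; exact hAh1
  have hbh2g : Valued.v bh = Valued.v ϖ ^ (2 * g) := by rw [← hjiso, hbh, hBhv, hjiso]
  -- the ray scalar `e₀ = T̂·(â + b̂V̂)` and `jE e₀ = Tr_ρ(μ∕D₀)` (★ K3)
  set e₀ : E := Th * (â + bh * Vh) with he₀def
  have he₀ : jE e₀ = μ / (jE ϖ ^ b * (α - ρ α) * Θ (dualGen ρ Θ α (jE ϖ ^ b) h x₀)) +
      ρ (μ / (jE ϖ ^ b * (α - ρ α) * Θ (dualGen ρ Θ α (jE ϖ ^ b) h x₀))) := by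
    rw [trace_scalar_eq_coords (ρ := ρ) (μ := μ) (b := b) hρρ hΘΘ hΘh hh hx₀ hα0 hjϖ0 hθ₀, he₀def, map_mul, map_add, map_mul, hTh, hâ, hbh, hVh,
      ← hTdef, ← hWdef]
    field_simp
  have he₀v : Valued.v e₀ = Valued.v ϖ ^ (d % 2) := by
    rw [hd0, pow_zero, he₀def, Valuation.map_mul, hTh1, one_mul]
    have hlt : Valued.v (bh * Vh) < Valued.v â := by
      rw [hâ1, Valuation.map_mul, hbh2g]
      calc Valued.v ϖ ^ (2 * g) * Valued.v Vh ≤ Valued.v ϖ ^ (2 * g) * 1 := by gcongr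
        _ < 1 := by rw [mul_one]; exact pow_lt_one₀ zero_le (by rw [hϖ, ← exp_zero, exp_lt_exp]; norm_num) (by omega)
    rw [Valuation.map_add_eq_of_lt_left _ hlt, hâ1]
  -- ray domination and the skew token (§1), the population token (★ DEFS), `Tr_ρ`-identity `lam − ρlam = μ − ρμ`
  have hlamμ : lam - ρ lam = μ - ρ μ := by rw [hμdef, map_sub, (hjfix _).2 ⟨_, rfl⟩]; ring
  obtain ⟨⟨hμeq, hμt⟩, hsk⟩ := v_hatmu_letters_of_row hU jE hjfix hϖM (lam := lam) (k := mstarOfRecord d) (n := n) hm hjl hlamμ hYv hmb hmg hn'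
  have hP : IsOrd ρ α (jE ϖ ^ b) (μ / dualGen ρ Θ α (jE ϖ ^ b) h x₀) :=
    (forall_herm_mul_mem_iff_isOrd_div hρρ hvρ hα hα1 hintρ hΘΘ hΘρ hvΘ hc hc0 hc1 hh hx₀ hΛx μ).1 hdep
  -- ★ p863048: the vertex is labelled by a `σ`-fixed unit `e′` near `e₀∕t₊`
  obtain ⟨e', hσe', he'1, hclose, hVS⟩ := exists_fixed_unit_valueSet_endoGL_sub_one_glued_eq_smul_xPlus hD H₂ hW jE hjv hjfix hρρ hvρ hα hα1 hintρ
    hΘΘ hΘρ hvΘ hΘj φ hφs hφγ hh hΘh hform hpr hintL hB hg₀ hg₀1 hprg u hc hc0 hc1 hcc hx₀ hBΛ hΛx hw₀Y hYO hμeq hμt le_rfl hΘlam hvlam huu hP he₀ he₀v hn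
    hlamn hun hsk
  -- ★ K4's sign property at `(T̂, V̂, e′)`
  have hsign : normSign σ e' = normSign σ Th * normSign σ (α₁ + γ₁ * Vh) := haff Th Vh e' hσTh hTh1 hσVh hVh1 hσe' hclose
  -- conclude through ★ `labelPlus_smul_xPlus_iff_exists_norm`
  rw [hVS, ← hsign]
  have key := labelPlus_smul_xPlus_iff_exists_norm hD hσe' he'1
  rw [LabelPlus, show d % 2 + 2 * d - 1 = mstarOfRecord d from rfl] at key
  rw [key]
  constructor
  · intro hN; exact normSign_of_isNorm σ hN
  · intro h1
    by_contra hN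
    rw [normSign_of_not_isNorm σ hN] at h1
    norm_num at h1

end Summit.HodgeConjecture.HodgeConjecture.Cruxes.H413.F0P3cDyRamDiagonalCellVertexRead

end
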